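import Mathlib
import Literature.Algebra.EuclideanLattices.FccBccLattices

/-!
# Route `CoarseStiffnessTail` — THE SLAB GAUSSIAN ON `ℝ³`: `∫_{|X| ≤ |A|} exp(−t·(|A|²|X|² − (A·X)²)) dX ≤ 6π/(t|A|)`
# (lead's certificate, seat `ym-line-cst-p1` g15; helper on 25301 `CappedCoarseStiffnessL`, stub S3 = uniform mean action, P2/(W2a))

THE INEQUALITY (`lintegral_closedBall_exp_quartic_le`, `A ∈ ℝ³ ∖ {0}`, `t > 0`): with the quartic
`K(A,X) = ‖A‖²‖X‖² − ⟪A,X⟫² = Σ_{i<j}(A_iX_j − A_jX_i)²` (the squared area of the parallelogram, i.e. `|A × X|²`),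

  `∫_{‖X‖ ≤ ‖A‖} e^{−t·K(A,X)} dX ≤ 6π/(t‖A‖)`.

PROOF.  Let `i` be a coordinate with `A_i² ≥ ‖A‖²/3`.  Dropping the square not involving `i`,
`K ≥ (A_iX_j − A_jX_i)² + (A_iX_k − A_kX_i)²`; on the slab `|X_i| ≤ ‖A‖` (containing the ball) the two remaining coordinates are
Gaussian of variance `(2tA_i²)⁻¹` around `(A_j/A_i)X_i`, `(A_k/A_i)X_i` (`∫ e^{−b(z−c)²}dz = √(π/b)`), so the slab integral is EXACTLY
`2‖A‖·π/(tA_i²) ≤ 6π/(t‖A‖)` (`lintegral_slab_eq`).  Integrating the coordinates is Mathlib's `lmarginal` on `Fin 3 → ℝ`.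

WHY (line card §g15, P2/W2).  After the exponential chart of `SU(2)` (`…LCommutatorChart`: `1 − Re tr[e^{iA},e^{iB}] ≥ (32/π⁴)K(A,B)` on the
quarter ball), the Haar integral `ψ(g) = ∫ 1[class angle of h ≤ that of g]·e^{−s(1−Re tr[g,h])} dh` is dominated by this slab Gaussian:
`ψ(e^{iA}) ≲ 1/(s‖A‖)`; squaring and integrating `‖A‖⁻²` over the ball of `ℝ³` (finite) gives the `s⁻²` decay of the commuting-triple
integral `J(s)` — the upper half of the `ε⁴` law (`…LCommVolumeUpper`).

HONEST SCOPE.  Calculus on `ℝ³`; nothing of Bałaban's is asserted; the crux 25301, its stubs S1/S2/S3, `HistoryTailL` 19936 stay OPEN;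
`YM3TorusSU2` (R3, RECORD rung, not Clay) is NOT proved; the Yang–Mills mass gap is NOT touched.

References: [folklore] (Gaussian integrals); I. Montvay, G. Münster, *Quantum Fields on a Lattice* (1994) §3.2.3 [MontvayMunster1994]
(the `SU(2)` chart behind the application).
-/

noncomputable section

open MeasureTheory Real
open scoped ENNReal BigOperators

namespace Summit.QuantumFields.YangMills.Theorems.CoarseStiffnessTailSlabGaussian

open Literature.Algebra.EuclideanLattices (norm_sq_fin_three inner_fin_three)

/-! ## §1 One-dimensional Gaussians with a linear shift -/

section OneDim

/-- `∫⁻ exp(−b(a z − c)²) dz = √(π/(b a²))` for `a ≠ 0`, `b > 0` (translate, then Mathlib's Gaussian integral). [folklore] -/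
theorem lintegral_exp_neg_mul_sq_affine {a b : ℝ} (ha : a ≠ 0) (hb : 0 < b) (c : ℝ) :
    ∫⁻ z : ℝ, ENNReal.ofReal (Real.exp (-(b * (a * z - c) ^ 2))) = ENNReal.ofReal (Real.sqrt (π / (b * a ^ 2))) := by
  have hba : 0 < b * a ^ 2 := mul_pos hb (by positivity)
  -- `(a z − c)² = a²(z − c/a)²`
  have hrew : ∀ z : ℝ, Real.exp (-(b * (a * z - c) ^ 2)) = Real.exp (-(b * a ^ 2) * (z - c / a) ^ 2) := by
    intro z; congr 1; field_simp
  simp_rw [hrew]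
  have hshift : ∫⁻ z : ℝ, ENNReal.ofReal (Real.exp (-(b * a ^ 2) * (z - c / a) ^ 2)) =
      ∫⁻ z : ℝ, ENNReal.ofReal (Real.exp (-(b * a ^ 2) * z ^ 2)) :=
    lintegral_sub_right_eq_self (μ := (volume : Measure ℝ)) (fun z => ENNReal.ofReal (Real.exp (-(b * a ^ 2) * z ^ 2))) (c / a)
  rw [hshift, ← ofReal_integral_eq_lintegral_ofReal (integrable_exp_neg_mul_sq hba)
    (Filter.Eventually.of_forall fun z => (Real.exp_pos _).le), integral_gaussian]

end OneDim

/-! ## §2 The slab integral on `Fin 3 → ℝ`, by `lmarginal` -/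

section Slab

/-- **THE SLAB INTEGRAL**: for `a : Fin 3 → ℝ` with `a i ≠ 0`, `t > 0`, `R : ℝ`, and `j, k` the two other coordinates,
`∫⁻ 1[−R ≤ x_i ≤ R]·exp(−t(a_ix_j − a_jx_i)²)·exp(−t(a_ix_k − a_kx_i)²) dx = (2R)₊·π/(t a_i²)` (as a product of `ofReal`s). [folklore] -/
theorem lintegral_slab_eq (a : Fin 3 → ℝ) (i j k : Fin 3) (hij : i ≠ j) (hik : i ≠ k) (hjk : j ≠ k) (hai : a i ≠ 0)
    {t : ℝ} (R : ℝ) (ht : 0 < t) :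
    ∫⁻ x : Fin 3 → ℝ, (Set.Icc (-R) R).indicator (fun _ => (1 : ℝ≥0∞)) (x i) *
        (ENNReal.ofReal (Real.exp (-(t * (a i * x j - a j * x i) ^ 2))) *
          ENNReal.ofReal (Real.exp (-(t * (a i * x k - a k * x i) ^ 2)))) =
      ENNReal.ofReal (2 * R) * (ENNReal.ofReal (Real.sqrt (π / (t * a i ^ 2))) * ENNReal.ofReal (Real.sqrt (π / (t * a i ^ 2)))) := by
  classical
  set c : ℝ≥0∞ := ENNReal.ofReal (Real.sqrt (π / (t * a i ^ 2))) with hc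
  -- measurability of the three factors
  have hmi : Measurable fun x : Fin 3 → ℝ => (Set.Icc (-R) R).indicator (fun _ => (1 : ℝ≥0∞)) (x i) :=
    (measurable_const.indicator measurableSet_Icc).comp (measurable_pi_apply i)
  have hq : ∀ m : Fin 3, Measurable fun x : Fin 3 → ℝ => ENNReal.ofReal (Real.exp (-(t * (a i * x m - a m * x i) ^ 2))) := by
    intro m
    refine (Measurable.exp (Measurable.neg ?_)).ennreal_ofReal
    exact (((measurable_pi_apply m).const_mul _).sub ((measurable_pi_apply i).const_mul _)).pow_const 2 |>.const_mul _
  have hmF : Measurable fun x : Fin 3 → ℝ => (Set.Icc (-R) R).indicator (fun _ => (1 : ℝ≥0∞)) (x i) *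
      (ENNReal.ofReal (Real.exp (-(t * (a i * x j - a j * x i) ^ 2))) *
        ENNReal.ofReal (Real.exp (-(t * (a i * x k - a k * x i) ^ 2)))) := hmi.mul ((hq j).mul (hq k))
  have hq1 : ∀ u v : ℝ, Measurable fun y : ℝ => ENNReal.ofReal (Real.exp (-(t * (u * y - v) ^ 2))) := by
    intro u v
    refine (Measurable.exp (Measurable.neg ?_)).ennreal_ofReal
    exact (((measurable_id.const_mul _).sub measurable_const).pow_const 2).const_mul _
  have hmF₁ : Measurable fun x : Fin 3 → ℝ => (Set.Icc (-R) R).indicator (fun _ => (1 : ℝ≥0∞)) (x i) *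
      ENNReal.ofReal (Real.exp (-(t * (a i * x j - a j * x i) ^ 2))) * c := (hmi.mul (hq j)).mul measurable_const
  have hmF₂ : Measurable fun x : Fin 3 → ℝ => (Set.Icc (-R) R).indicator (fun _ => (1 : ℝ≥0∞)) (x i) * c * c :=
    (hmi.mul measurable_const).mul measurable_const
  -- the integral is the full marginal; `univ = insert k (insert j {i})`
  rw [volume_pi, lintegral_eq_lmarginal_univ (fun _ => (0 : ℝ))]
  have hk' : k ∉ insert j ({i} : Finset (Fin 3)) := by simp [hjk.symm, hik.symm]
  have hj' : j ∉ ({i} : Finset (Fin 3)) := by simp [hij.symm]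
  have huniv : insert k (insert j ({i} : Finset (Fin 3))) = Finset.univ := by
    apply Finset.eq_univ_of_card
    rw [Finset.card_insert_of_notMem hk', Finset.card_insert_of_notMem hj', Finset.card_singleton, Fintype.card_fin]
  rw [← huniv, lmarginal_insert' _ hmF hk']
  -- peel `k`
  have hstep₁ : (fun x : Fin 3 → ℝ => ∫⁻ y, (Set.Icc (-R) R).indicator (fun _ => (1 : ℝ≥0∞)) ((Function.update x k y) i) *
      (ENNReal.ofReal (Real.exp (-(t * (a i * (Function.update x k y) j - a j * (Function.update x k y) i) ^ 2))) *
        ENNReal.ofReal (Real.exp (-(t * (a i * (Function.update x k y) k - a k * (Function.update x k y) i) ^ 2))))) =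
      fun x => (Set.Icc (-R) R).indicator (fun _ => (1 : ℝ≥0∞)) (x i) *
        ENNReal.ofReal (Real.exp (-(t * (a i * x j - a j * x i) ^ 2))) * c := by
    funext x
    simp only [Function.update_self, Function.update_of_ne hik, Function.update_of_ne hjk]
    have h1 : ∀ y : ℝ, (Set.Icc (-R) R).indicator (fun _ => (1 : ℝ≥0∞)) (x i) *
        (ENNReal.ofReal (Real.exp (-(t * (a i * x j - a j * x i) ^ 2))) * ENNReal.ofReal (Real.exp (-(t * (a i * y - a k * x i) ^ 2)))) =
        ((Set.Icc (-R) R).indicator (fun _ => (1 : ℝ≥0∞)) (x i) * ENNReal.ofReal (Real.exp (-(t * (a i * x j - a j * x i) ^ 2)))) *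
          ENNReal.ofReal (Real.exp (-(t * (a i * y - a k * x i) ^ 2))) := fun y => by ring
    simp_rw [h1]
    rw [lintegral_const_mul _ (hq1 (a i) (a k * x i)), lintegral_exp_neg_mul_sq_affine hai ht]
  rw [hstep₁, lmarginal_insert' _ hmF₁ hj']
  -- peel `j`
  have hstep₂ : (fun x : Fin 3 → ℝ => ∫⁻ y, (Set.Icc (-R) R).indicator (fun _ => (1 : ℝ≥0∞)) ((Function.update x j y) i) *
      ENNReal.ofReal (Real.exp (-(t * (a i * (Function.update x j y) j - a j * (Function.update x j y) i) ^ 2))) * c) =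
      fun x => (Set.Icc (-R) R).indicator (fun _ => (1 : ℝ≥0∞)) (x i) * c * c := by
    funext x
    simp only [Function.update_self, Function.update_of_ne hij]
    have h1 : ∀ y : ℝ, (Set.Icc (-R) R).indicator (fun _ => (1 : ℝ≥0∞)) (x i) *
        ENNReal.ofReal (Real.exp (-(t * (a i * y - a j * x i) ^ 2))) * c =
        ((Set.Icc (-R) R).indicator (fun _ => (1 : ℝ≥0∞)) (x i) * c) * ENNReal.ofReal (Real.exp (-(t * (a i * y - a j * x i) ^ 2))) :=
      fun y => by ring
    simp_rw [h1]
    rw [lintegral_const_mul _ (hq1 (a i) (a j * x i)), lintegral_exp_neg_mul_sq_affine hai ht]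
  rw [hstep₂, lmarginal_singleton]
  -- the last coordinate: `∫ 1[|y| ≤ R] dy = 2R`
  simp only [Function.update_self]
  have h1 : ∀ y : ℝ, (Set.Icc (-R) R).indicator (fun _ => (1 : ℝ≥0∞)) y * c * c =
      (Set.Icc (-R) R).indicator (fun _ => c * c) y := by
    intro y
    by_cases hy : y ∈ Set.Icc (-R) R
    · simp [Set.indicator_of_mem hy]
    · simp [Set.indicator_of_notMem hy]
  simp_rw [h1]
  rw [lintegral_indicator_const measurableSet_Icc, Real.volume_Icc]
  rw [show R - -R = 2 * R by ring]
  ring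

end Slab

/-! ## §3 On `ℝ³ = EuclideanSpace ℝ (Fin 3)`: the ball integral of `exp(−t·K(A,X))` -/

section Ball

/-- **Lagrange minus one square**: for each coordinate `i` (others `j ≠ k`),
`(A_iX_j − A_jX_i)² + (A_iX_k − A_kX_i)² ≤ ‖A‖²‖X‖² − ⟪A,X⟫²`. [folklore] -/
theorem two_squares_le_quartic (A X : EuclideanSpace ℝ (Fin 3)) (i j k : Fin 3) (hij : i ≠ j) (hik : i ≠ k) (hjk : j ≠ k) :
    (A i * X j - A j * X i) ^ 2 + (A i * X k - A k * X i) ^ 2 ≤ ‖A‖ ^ 2 * ‖X‖ ^ 2 - inner ℝ A X ^ 2 := by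
  rw [norm_sq_fin_three, norm_sq_fin_three, inner_fin_three]
  fin_cases i <;> fin_cases j <;> fin_cases k <;> simp_all <;>
    nlinarith [sq_nonneg (A 0 * X 1 - A 1 * X 0), sq_nonneg (A 0 * X 2 - A 2 * X 0), sq_nonneg (A 1 * X 2 - A 2 * X 1)]

/-- A coordinate carrying a third of the norm: `∃ i, ‖A‖² ≤ 3 A_i²`. [folklore] -/
theorem exists_coord_sq_ge (A : EuclideanSpace ℝ (Fin 3)) : ∃ i : Fin 3, ‖A‖ ^ 2 ≤ 3 * A i ^ 2 := by
  by_contra! h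
  have h0 := h 0; have h1 := h 1; have h2 := h 2
  rw [norm_sq_fin_three] at h0 h1 h2
  nlinarith

/-- **★ THE BALL INTEGRAL**: for `A ≠ 0` and `t > 0`,
`∫⁻_{‖X‖ ≤ ‖A‖} exp(−t(‖A‖²‖X‖² − ⟪A,X⟫²)) dX ≤ 6π/(t‖A‖)` (as `ofReal`). [folklore] -/
theorem lintegral_closedBall_exp_quartic_le (A : EuclideanSpace ℝ (Fin 3)) (hA : A ≠ 0) {t : ℝ} (ht : 0 < t) :
    ∫⁻ X in Metric.closedBall (0 : EuclideanSpace ℝ (Fin 3)) ‖A‖,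
        ENNReal.ofReal (Real.exp (-(t * (‖A‖ ^ 2 * ‖X‖ ^ 2 - inner ℝ A X ^ 2)))) ≤
      ENNReal.ofReal (6 * π / (t * ‖A‖)) := by
  classical
  have hA0 : 0 < ‖A‖ := norm_pos_iff.2 hA
  obtain ⟨i, hi⟩ := exists_coord_sq_ge A
  have hai : A i ≠ 0 := by
    intro h; rw [h] at hi; nlinarith [hA0]
  -- the two other coordinates
  obtain ⟨j, k, hij, hik, hjk⟩ : ∃ j k : Fin 3, i ≠ j ∧ i ≠ k ∧ j ≠ k := by
    fin_cases i
    · exact ⟨1, 2, by decide, by decide, by decide⟩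
    · exact ⟨0, 2, by decide, by decide, by decide⟩
    · exact ⟨0, 1, by decide, by decide, by decide⟩
  -- the slab integrand on `Fin 3 → ℝ`
  have hmi : Measurable fun x : Fin 3 → ℝ => (Set.Icc (-‖A‖) ‖A‖).indicator (fun _ => (1 : ℝ≥0∞)) (x i) :=
    (measurable_const.indicator measurableSet_Icc).comp (measurable_pi_apply i)
  have hq : ∀ m : Fin 3, Measurable fun x : Fin 3 → ℝ =>
      ENNReal.ofReal (Real.exp (-(t * ((WithLp.ofLp A) i * x m - (WithLp.ofLp A) m * x i) ^ 2))) := by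
    intro m
    refine (Measurable.exp (Measurable.neg ?_)).ennreal_ofReal
    exact (((measurable_pi_apply m).const_mul _).sub ((measurable_pi_apply i).const_mul _)).pow_const 2 |>.const_mul _
  have hmF : Measurable fun x : Fin 3 → ℝ => (Set.Icc (-‖A‖) ‖A‖).indicator (fun _ => (1 : ℝ≥0∞)) (x i) *
      (ENNReal.ofReal (Real.exp (-(t * ((WithLp.ofLp A) i * x j - (WithLp.ofLp A) j * x i) ^ 2))) *
        ENNReal.ofReal (Real.exp (-(t * ((WithLp.ofLp A) i * x k - (WithLp.ofLp A) k * x i) ^ 2)))) :=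
    hmi.mul ((hq j).mul (hq k))
  -- pointwise domination on the ball
  have hdom : ∀ X : EuclideanSpace ℝ (Fin 3), X ∈ Metric.closedBall (0 : EuclideanSpace ℝ (Fin 3)) ‖A‖ →
      ENNReal.ofReal (Real.exp (-(t * (‖A‖ ^ 2 * ‖X‖ ^ 2 - inner ℝ A X ^ 2)))) ≤
        (Set.Icc (-‖A‖) ‖A‖).indicator (fun _ => (1 : ℝ≥0∞)) ((WithLp.ofLp X) i) *
          (ENNReal.ofReal (Real.exp (-(t * ((WithLp.ofLp A) i * (WithLp.ofLp X) j - (WithLp.ofLp A) j * (WithLp.ofLp X) i) ^ 2))) *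
            ENNReal.ofReal (Real.exp (-(t * ((WithLp.ofLp A) i * (WithLp.ofLp X) k - (WithLp.ofLp A) k * (WithLp.ofLp X) i) ^ 2)))) := by
    intro X hX
    rw [Metric.mem_closedBall, dist_zero_right] at hX
    have hXi : (WithLp.ofLp X) i ∈ Set.Icc (-‖A‖) ‖A‖ := by
      have h2 : X i ^ 2 ≤ ‖A‖ ^ 2 := by
        have h3 : X i ^ 2 ≤ ‖X‖ ^ 2 := by
          rw [norm_sq_fin_three]
          fin_cases i <;> simp <;> nlinarith [sq_nonneg (X 0), sq_nonneg (X 1), sq_nonneg (X 2)]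
        exact h3.trans (pow_le_pow_left₀ (norm_nonneg _) hX 2)
      exact abs_le_of_sq_le_sq' h2 hA0.le
    rw [Set.indicator_of_mem hXi, one_mul, ← ENNReal.ofReal_mul (Real.exp_pos _).le, ← Real.exp_add]
    apply ENNReal.ofReal_le_ofReal
    apply Real.exp_le_exp.2
    have hK := two_squares_le_quartic A X i j k hij hik hjk
    have := mul_le_mul_of_nonneg_left hK ht.le
    linarith
  -- assemble
  calc ∫⁻ X in Metric.closedBall (0 : EuclideanSpace ℝ (Fin 3)) ‖A‖,
          ENNReal.ofReal (Real.exp (-(t * (‖A‖ ^ 2 * ‖X‖ ^ 2 - inner ℝ A X ^ 2))))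
      ≤ ∫⁻ X in Metric.closedBall (0 : EuclideanSpace ℝ (Fin 3)) ‖A‖,
          (Set.Icc (-‖A‖) ‖A‖).indicator (fun _ => (1 : ℝ≥0∞)) ((WithLp.ofLp X) i) *
            (ENNReal.ofReal (Real.exp (-(t * ((WithLp.ofLp A) i * (WithLp.ofLp X) j - (WithLp.ofLp A) j * (WithLp.ofLp X) i) ^ 2))) *
              ENNReal.ofReal (Real.exp (-(t * ((WithLp.ofLp A) i * (WithLp.ofLp X) k - (WithLp.ofLp A) k * (WithLp.ofLp X) i) ^ 2)))) :=
        setLIntegral_mono' Metric.isClosed_closedBall.measurableSet hdom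
    _ ≤ ∫⁻ X : EuclideanSpace ℝ (Fin 3),
          (Set.Icc (-‖A‖) ‖A‖).indicator (fun _ => (1 : ℝ≥0∞)) ((WithLp.ofLp X) i) *
            (ENNReal.ofReal (Real.exp (-(t * ((WithLp.ofLp A) i * (WithLp.ofLp X) j - (WithLp.ofLp A) j * (WithLp.ofLp X) i) ^ 2))) *
              ENNReal.ofReal (Real.exp (-(t * ((WithLp.ofLp A) i * (WithLp.ofLp X) k - (WithLp.ofLp A) k * (WithLp.ofLp X) i) ^ 2)))) :=
        setLIntegral_le_lintegral _ _
    _ = ∫⁻ x : Fin 3 → ℝ, (Set.Icc (-‖A‖) ‖A‖).indicator (fun _ => (1 : ℝ≥0∞)) (x i) *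
          (ENNReal.ofReal (Real.exp (-(t * ((WithLp.ofLp A) i * x j - (WithLp.ofLp A) j * x i) ^ 2))) *
            ENNReal.ofReal (Real.exp (-(t * ((WithLp.ofLp A) i * x k - (WithLp.ofLp A) k * x i) ^ 2)))) :=
        (PiLp.volume_preserving_ofLp (Fin 3)).lintegral_comp hmF
    _ = ENNReal.ofReal (2 * ‖A‖) * (ENNReal.ofReal (Real.sqrt (π / (t * (WithLp.ofLp A) i ^ 2))) *
          ENNReal.ofReal (Real.sqrt (π / (t * (WithLp.ofLp A) i ^ 2)))) :=
        lintegral_slab_eq (WithLp.ofLp A) i j k hij hik hjk hai ‖A‖ ht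
    _ = ENNReal.ofReal (2 * ‖A‖ * π / (t * A i ^ 2)) := by
        have hx : 0 ≤ π / (t * A i ^ 2) := by positivity
        rw [← ENNReal.ofReal_mul (Real.sqrt_nonneg _), Real.mul_self_sqrt hx, ← ENNReal.ofReal_mul (by positivity)]
        congr 1
        ring
    _ ≤ ENNReal.ofReal (6 * π / (t * ‖A‖)) := by
        apply ENNReal.ofReal_le_ofReal
        have ha2 : 0 < A i ^ 2 := by positivity
        rw [div_le_div_iff₀ (by positivity) (by positivity)]
        nlinarith [mul_le_mul_of_nonneg_left hi (mul_pos Real.pi_pos ht).le]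

end Ball

end Summit.QuantumFields.YangMills.Theorems.CoarseStiffnessTailSlabGaussian

end
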